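import Literature.NumberTheory.EllipticCurves.Kato2004.EllipticUnitKummerCupMap
import Literature.NumberTheory.EllipticCurves.DivisionValuesRootsOfUnity
import Literature.NumberTheory.EllipticCurves.TateModuleFinrankProofs
import HarnessLib

/-!
# Kato 2004 (Astérisque 295) §15.5 — (F∃)-1: the Kummer frame ON THE TORSION TOWER `V s = Gal(K̄/K(E[p^s f]))` EXISTS
# (compatible primitive `p^k`-th roots of unity in `K̄`; `μ_{p^k} ⊆ K(E[p^k])` by the Weil pairing; `γ ∈ T_pE` levelwise)

Topic `NumberTheory/EllipticCurves`, sub-directory `Kato2004`.  Definitions with bodies and theorems: **no named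
fact** (D-0026);
no instance, no notation, no `sorry`.  Number field `K`, ANY elliptic `E : WeierstrassCurve K`, ANY prime `p`, ANY `f ≥ 1`; no
complex multiplication inside.

This is the first half of the existence statement `(F∃)_K` (planner `bsd-cm` D1034/D1036, row K2C-11: the hypothesis `hF` of
`CM.prop159_ellipticUnits_expStar_values_of_kummerCup`, `Kato2004/EllipticUnitKummerCupValues.lean`): for every elliptic `E/K`,
prime `p`, `f ≥ 1` and `γ ∈ T_pE` there IS a Kummer frame (`Kato2004/EllipticUnitKummerCupMap.lean`) with levels the torsion
kernels `V s = torsionLayer E (p^s f) = Gal(K̄/K(E[p^s f]))` and torsion points `e k = γ mod p^k`, and `γ ≠ 0` gives `e k ≠ 0`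
for some `k`; non-zero `γ` exist (`rank_{ℤ_p} T_pE = 2`).  The one non-formal input is Silverman *AEC* III Cor. 8.1.1
«`E[m] ⊂ E(L) ⟹ μ_m ⊂ L`» (the tree's `exists_isPrimitiveRoot_fixed`, from the Weil pairing), which supplies the frame axiom
(b1) «`V s` fixes `ζ k` for `k ≤ s`»; the compatible system `ζ (k+1)^p = ζ k` of primitive roots is built by recursion in the
algebraically closed field `K̄` (§1).  The second half of `(F∃)_K` — the unit tower of Kato's `_𝔞z_{p^s𝔣}` on this frame (norm
relation de Shalit II 2.5 (i) in coset form, `p`-units) — is CM-specific and is the sequel file.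

* §1 `exists_isPrimitiveRoot_succ_pow_eq` (a primitive `p^{k+1}`-th root with prescribed `p`-th power),
`primitiveRootSystem K p k`
  (recursive compatible system), `primitiveRootSystem_succ_pow`, `primitiveRootUnit`, `isPrimitiveRoot_primitiveRootUnit`,
  `primitiveRootUnit_succ_pow`.
* §2 `smul_eq_of_mem_torsionLayer` / `mem_torsionLayer_of_forall_smul_eq` (unfolding `torsionLayer = ker ρ̄_{E,m}`),
  `torsionLayer_anti` (`m ∣ m' ⟹ V_{m'} ≤ V_m`), `exists_geomPoint_exactOrder` (a point of exact order `p^k`, from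
`#E[p^k] = p^{2k}`),
  ★ `smul_eq_of_isPrimitiveRoot_of_mem_torsionLayer` («`μ_{p^k} ⊆ K(E[m])` for `p^k ∣ m`», Cor. III.8.1.1 in Galois form).
* §3 ★ `KummerFrame.ofTorsionTower E p f hf γ : KummerFrame E p` (ALL fields proved), `ofTorsionTower_V` (`rfl`),
  `ofTorsionTower_e`, `exists_ofTorsionTower_e_ne_zero` (`γ ≠ 0`), `exists_tateModule_ne_zero`, and the packaged
  ★ `exists_kummerFrame_torsionTower : ∃ F : KummerFrame E p, (∀ s, F.V s = torsionLayer E (p ^ s * f)) ∧ ∃ k, F.e k ≠ 0` — the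
  frame clause of `(F∃)_K` verbatim (with `E := A.baseChange K`).

Dictionary `ℚ ↔ K`: none.  GENERALISE-VS-DUPLICATE: new notions `primitiveRootSystem`/`primitiveRootUnit`,
`KummerFrame.ofTorsionTower`;
engines BY NAME: `exists_isPrimitiveRoot_fixed` (`DivisionValuesRootsOfUnity`), `card_torsionPoints_eq_sq_holds`,
`isOpen_ker_galoisRepTorsion_holds` (`GaloisActionProofs`), `finrank_tateModule_eq_two_holds`
(`TateModuleFinrankProofs`), `tateModPkK`
(T2a); nothing re-declared.  CONSUMER BY NAME: hypothesis `hF` of `CM.prop159_ellipticUnits_expStar_values_of_kummerCup` (frame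
clause) and, downstream, the `KummerFrame` input of `GenusSeven.PinnedKatoGenusFrame`'s `euK` column.  HONEST
FRAMING: elementary
Galois bookkeeping + one use of the Weil pairing; proves nothing about any particular curve; no summit statement is proved.

## References

* [Kato2004Asterisque] K. Kato, Astérisque 295 (2004), §15.3 (15.3.1)–(15.3.3) (p. 252), §15.5 (p. 253), (15.6.1) (p. 253),
  (15.12.1) (p. 263).
* [SilvermanAEC2009] J. H. Silverman, *The Arithmetic of Elliptic Curves* (2009), III.6.4 (b), III.7.1 (a), III.8.1,
Cor. III.8.1.1.
* [Rubin2000] K. Rubin, *Euler Systems* (2000), §B.3 (compatible systems; `ℤ_p(1) = lim μ_{p^k}`).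
-/

noncomputable section

open scoped NumberField
open Field IsDedekindDomain Polynomial
open Literature.NumberTheory.GaloisRepresentations
open Literature.NumberTheory.EllipticCurves
open WeierstrassCurve (geomPoints geomTorsion)

namespace Literature.NumberTheory.EllipticCurves.Kato2004

/-! ## §1 Compatible systems of primitive `p`-power roots of unity in `K̄` -/

section Roots

variable (K : Type) [Field K] [CharZero K] (p : ℕ) [Fact p.Prime]

/-- **Successor step**: a primitive `p^k`-th root of unity in `K̄` has a `p`-th root which is a primitive `p^{k+1}`-th root of
unity (`k = 0`: a root of `Φ_p`; `k ≥ 1`: ANY root of `X^p − ζ`, by the order computation `ord(w)/gcd(ord(w), p) = p^k`).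
[cite: Rubin2000, App. B §B.3 (ℤ_p(1) = lim μ_{p^k})] [cite: SilvermanAEC2009, III.8 (μ_N)] -/
theorem exists_isPrimitiveRoot_succ_pow_eq (k : ℕ) {ζ : AlgebraicClosure K} (hζ : IsPrimitiveRoot ζ (p ^ k)) :
    ∃ w : AlgebraicClosure K, IsPrimitiveRoot w (p ^ (k + 1)) ∧ w ^ p = ζ := by
  haveI : CharZero (AlgebraicClosure K) :=
    charZero_of_injective_algebraMap (algebraMap K (AlgebraicClosure K)).injective
  have hp : p.Prime := Fact.out
  rcases Nat.eq_zero_or_pos k with rfl | hk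
  · -- `ζ = 1`: take a root of the cyclotomic polynomial `Φ_p`
    rw [pow_zero, IsPrimitiveRoot.one_right_iff] at hζ
    subst hζ
    obtain ⟨w, hw⟩ := IsAlgClosed.exists_root (cyclotomic (p ^ (0 + 1)) (AlgebraicClosure K))
      (by rw [degree_cyclotomic]; exact_mod_cast (Nat.totient_pos.mpr (pow_pos hp.pos _)).ne')
    have hw' : IsPrimitiveRoot w (p ^ (0 + 1)) := (isRoot_cyclotomic_iff_charZero (pow_pos hp.pos _)).mp hw
    exact ⟨w, hw', by simpa using hw'.pow_eq_one⟩
  · obtain ⟨w, hw⟩ := IsAlgClosed.exists_root ((X : (AlgebraicClosure K)[X]) ^ p - C ζ)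
      (by rw [degree_X_pow_sub_C hp.pos]; exact_mod_cast hp.ne_zero)
    have hwp : w ^ p = ζ := by
      have := hw
      rw [IsRoot.def, eval_sub, eval_pow, eval_X, eval_C, sub_eq_zero] at this
      exact this
    refine ⟨w, ?_, hwp⟩
    have h1 : w ^ p ^ (k + 1) = 1 := by rw [pow_succ', pow_mul, hwp, hζ.pow_eq_one]
    obtain ⟨j, _, hj⟩ := (Nat.dvd_prime_pow hp).mp (orderOf_dvd_of_pow_eq_one h1)
    have hord : orderOf (w ^ p) = p ^ k := by rw [hwp]; exact hζ.eq_orderOf.symm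
    rw [orderOf_pow' w hp.ne_zero, hj] at hord
    rcases Nat.eq_zero_or_pos j with rfl | hj0
    · -- `orderOf w = 1`: then `p^k = 1`, impossible for `k ≥ 1`
      rw [pow_zero, Nat.gcd_one_left, Nat.div_one] at hord
      exact absurd hord.symm (Nat.one_lt_pow hk.ne' hp.one_lt).ne'
    · obtain ⟨j', rfl⟩ : ∃ j', j = j' + 1 := ⟨j - 1, by omega⟩
      rw [Nat.gcd_eq_right (dvd_pow_self p (Nat.succ_ne_zero j')), pow_succ, Nat.mul_div_cancel _ hp.pos] at hord
      have hjk : j' = k := Nat.pow_right_injective hp.two_le hord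
      rw [← hjk, ← hj]
      exact IsPrimitiveRoot.orderOf w

/-- **A compatible system of primitive `p^k`-th roots of unity in `K̄`** (`ζ_0 = 1`, `ζ_{k+1}^p = ζ_k`), by recursion on
`exists_isPrimitiveRoot_succ_pow_eq` — a generator of `ℤ_p(1) = lim← μ_{p^k}`. [cite: Rubin2000, App. B §B.3] [cite:
Kato2004Asterisque, (15.6.1) (p. 253, 𝐇¹(ℤ_p(1)))] -/
def primitiveRootSystem : (k : ℕ) → {z : AlgebraicClosure K // IsPrimitiveRoot z (p ^ k)}
  | 0 => ⟨1, by rw [pow_zero]; exact IsPrimitiveRoot.one⟩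
  | k + 1 => ⟨(exists_isPrimitiveRoot_succ_pow_eq K p k (primitiveRootSystem k).2).choose,
      (exists_isPrimitiveRoot_succ_pow_eq K p k (primitiveRootSystem k).2).choose_spec.1⟩

/-- Compatibility `ζ_{k+1}^p = ζ_k`. [cite: Rubin2000, App. B §B.3] -/
theorem primitiveRootSystem_succ_pow (k : ℕ) :
    ((primitiveRootSystem K p (k + 1)).1) ^ p = (primitiveRootSystem K p k).1 :=
  (exists_isPrimitiveRoot_succ_pow_eq K p k (primitiveRootSystem K p k).2).choose_spec.2

/-- The system as units of `K̄`. [cite: Kato2004Asterisque, (15.6.1) (p. 253)] -/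
def primitiveRootUnit (k : ℕ) : (AlgebraicClosure K)ˣ :=
  Units.mk0 (primitiveRootSystem K p k).1
    ((primitiveRootSystem K p k).2.ne_zero (pow_ne_zero _ (Fact.out : p.Prime).ne_zero))

/-- `primitiveRootUnit K p k` is a primitive `p^k`-th root of unity. [cite: Kato2004Asterisque, (15.6.1) (p. 253)] -/
theorem isPrimitiveRoot_primitiveRootUnit (k : ℕ) : IsPrimitiveRoot (primitiveRootUnit K p k) (p ^ k) :=
  IsPrimitiveRoot.coe_units_iff.mp (by rw [primitiveRootUnit, Units.val_mk0]; exact (primitiveRootSystem K p k).2)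

/-- Compatibility of the units: `ζ_{k+1}^p = ζ_k`. [cite: Rubin2000, App. B §B.3] -/
theorem primitiveRootUnit_succ_pow (k : ℕ) : primitiveRootUnit K p (k + 1) ^ p = primitiveRootUnit K p k :=
  Units.ext (by rw [Units.val_pow_eq_pow_val, primitiveRootUnit, primitiveRootUnit, Units.val_mk0, Units.val_mk0,
    primitiveRootSystem_succ_pow])

end Roots

/-! ## §2 The torsion kernels: unfolding, monotonicity, a point of exact order `p^k`, and `μ_{p^k} ⊆ K(E[m])` -/

section Torsion

variable {K : Type} [Field K] (E : WeierstrassCurve K)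

/-- `σ ∈ Gal(K̄/K(E[m]))` fixes every `m`-torsion point (unfolding `torsionLayer = ker ρ̄_{E,m}`).
[cite: Kato2004Asterisque, §15.3 (15.3.1)–(15.3.3) (p. 252)] -/
theorem smul_eq_of_mem_torsionLayer {m : ℕ} {σ : absoluteGaloisGroup K} (hσ : σ ∈ CM.torsionLayer E m)
    (P : geomPoints E) (hP : (m : ℤ) • P = 0) : σ • P = P := by
  have h1 : σ • (⟨P, (Submodule.mem_torsionBy_iff (R := ℤ) _ _).mpr hP⟩ : geomTorsion E (m : ℤ)) =
      ⟨P, (Submodule.mem_torsionBy_iff (R := ℤ) _ _).mpr hP⟩ := by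
    rw [← WeierstrassCurve.galoisRepTorsion_apply, MonoidHom.mem_ker.mp hσ]
    rfl
  exact congrArg Subtype.val h1

/-- Conversely, an element fixing every `m`-torsion point lies in `Gal(K̄/K(E[m]))`. [cite: Kato2004Asterisque, §15.3
(p. 252)] -/
theorem mem_torsionLayer_of_forall_smul_eq {m : ℕ} {σ : absoluteGaloisGroup K}
    (h : ∀ P : geomPoints E, (m : ℤ) • P = 0 → σ • P = P) : σ ∈ CM.torsionLayer E m := by
  refine MonoidHom.mem_ker.mpr (Multiplicative.toAdd.injective (AddEquiv.ext fun P ↦ ?_))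
  rw [WeierstrassCurve.galoisRepTorsion_apply]
  exact Subtype.ext (h P ((Submodule.mem_torsionBy_iff (R := ℤ) _ _).mp P.2))

/-- **Monotonicity of the torsion kernels**: `m ∣ m' ⟹ Gal(K̄/K(E[m'])) ≤ Gal(K̄/K(E[m]))` (`E[m] ⊆ E[m']`).
[cite: Kato2004Asterisque, §15.1 (p. 250, the tower K(p^n𝔣)) and §15.3 (p. 252)] -/
theorem torsionLayer_anti {m m' : ℕ} (h : m ∣ m') : CM.torsionLayer E m' ≤ CM.torsionLayer E m := by
  intro σ hσ
  refine mem_torsionLayer_of_forall_smul_eq E fun P hP ↦ smul_eq_of_mem_torsionLayer E hσ P ?_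
  obtain ⟨c, rfl⟩ := h
  rw [Nat.cast_mul, mul_comm, mul_zsmul, hP, zsmul_zero]

variable [E.IsElliptic] (p : ℕ) [Fact p.Prime]

/-- **A geometric point of exact order `p^k`** (`k ≥ 1`), from `#E[p^k] = p^{2k}` and `#E[p^{k−1}] = p^{2k−2}`
(Silverman III.6.4 (b),
the tree's `card_torsionPoints_eq_sq_holds`): not every point of `E[p^k]` is killed by `p^{k−1}`, and such a point
has exact order
`p^k`. [cite: SilvermanAEC2009, Cor. III.6.4 (b)] -/
theorem exists_geomPoint_exactOrder [CharZero K] (k : ℕ) (hk : 1 ≤ k) :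
    ∃ T₀ : geomPoints E, ((p ^ k : ℕ) : ℤ) • T₀ = 0 ∧ ∀ d : ℕ, 0 < d → d < p ^ k → (d : ℤ) • T₀ ≠ 0 := by
  haveI : CharZero (AlgebraicClosure K) :=
    charZero_of_injective_algebraMap (algebraMap K (AlgebraicClosure K)).injective
  have hp : p.Prime := Fact.out
  obtain ⟨j, rfl⟩ : ∃ j, k = j + 1 := ⟨k - 1, by omega⟩
  have hcard : ∀ n : ℕ, Nat.card (geomTorsion E ((p ^ n : ℕ) : ℤ)) = (p ^ n) ^ 2 := fun n ↦
    WeierstrassCurve.card_torsionPoints_eq_sq_holds E (AlgebraicClosure K) (n := p ^ n)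
      (by exact_mod_cast pow_ne_zero n hp.ne_zero)
  -- a point of `E[p^{j+1}]` not killed by `p^j`
  have hex : ∃ T : geomTorsion E ((p ^ (j + 1) : ℕ) : ℤ), ((p ^ j : ℕ) : ℤ) • (T : geomPoints E) ≠ 0 := by
    by_contra hall
    have hall' : ∀ T : geomTorsion E ((p ^ (j + 1) : ℕ) : ℤ), ((p ^ j : ℕ) : ℤ) • (T : geomPoints E) = 0 := fun T ↦
      not_not.mp (not_exists.mp hall T)
    have hle : geomTorsion E ((p ^ (j + 1) : ℕ) : ℤ) ≤ geomTorsion E ((p ^ j : ℕ) : ℤ) := fun P hP ↦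
      (Submodule.mem_torsionBy_iff (R := ℤ) _ _).mpr (hall' ⟨P, hP⟩)
    haveI : Finite (geomTorsion E ((p ^ j : ℕ) : ℤ)) :=
      Nat.finite_of_card_ne_zero (by rw [hcard j]; exact pow_ne_zero _ (pow_ne_zero _ hp.ne_zero))
    have hle' := Nat.card_le_card_of_injective _ (AddSubgroup.inclusion_injective hle)
    rw [hcard (j + 1), hcard j] at hle'
    exact absurd hle' (not_le.mpr (Nat.pow_lt_pow_left (Nat.pow_lt_pow_right hp.one_lt (by omega)) two_ne_zero))
  obtain ⟨T, hT⟩ := hex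
  refine ⟨T, (Submodule.mem_torsionBy_iff (R := ℤ) _ _).mp T.2, fun d hd hdq hdT ↦ hT ?_⟩
  -- the order of `T` is `p^i`; `d • T = 0` with `d < p^{j+1}` forces `i ≤ j`
  have ho : addOrderOf (T : geomPoints E) ∣ p ^ (j + 1) :=
    addOrderOf_dvd_of_nsmul_eq_zero (by rw [← natCast_zsmul]; exact (Submodule.mem_torsionBy_iff (R := ℤ) _ _).mp T.2)
  obtain ⟨i, hi, hio⟩ := (Nat.dvd_prime_pow hp).mp ho
  have hdi : p ^ i ∣ d := hio ▸ addOrderOf_dvd_of_nsmul_eq_zero (by rw [← natCast_zsmul]; exact hdT)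
  have hij : i ≤ j := by
    by_contra hij
    have : i = j + 1 := by omega
    subst this
    exact absurd (Nat.le_of_dvd hd hdi) (not_le.mpr hdq)
  rw [natCast_zsmul]
  exact addOrderOf_dvd_iff_nsmul_eq_zero.mp (hio ▸ pow_dvd_pow p hij)

/-- ★ **`μ_{p^k} ⊆ K(E[m])` for `p^k ∣ m`, in Galois form** (Silverman *AEC* III Cor. 8.1.1 «if `E[N] ⊂ E(L)` then
`μ_N ⊂ L`», via the
tree's `exists_isPrimitiveRoot_fixed` = the Weil pairing): every `σ ∈ Gal(K̄/K(E[m]))` fixes every primitive `p^k`-th root of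
unity. [cite: SilvermanAEC2009, Cor. III.8.1.1] [cite: Kato2004Asterisque, §15.5 (p. 253)] -/
theorem smul_eq_of_isPrimitiveRoot_of_mem_torsionLayer [CharZero K] (k : ℕ) {m : ℕ} (hkm : p ^ k ∣ m)
    {σ : absoluteGaloisGroup K} (hσ : σ ∈ CM.torsionLayer E m) {ζ : AlgebraicClosure K} (hζ : IsPrimitiveRoot ζ (p ^ k)) :
    σ • ζ = ζ := by
  have hp : p.Prime := Fact.out
  rcases Nat.eq_zero_or_pos k with rfl | hk
  · rw [pow_zero, IsPrimitiveRoot.one_right_iff] at hζ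
    rw [hζ, smul_one]
  have hq : 2 ≤ p ^ k := (Nat.one_lt_pow hk.ne' hp.one_lt : 1 < p ^ k)
  obtain ⟨ζ', hζ', hfix⟩ := exists_isPrimitiveRoot_fixed (E := E) hq (exists_geomPoint_exactOrder E p k hk)
  have hσ' : σ • ζ' = ζ' := hfix σ fun T ↦ Subtype.ext (by
    rw [AddSubgroup.torsionBy.coe_smul]
    exact smul_eq_of_mem_torsionLayer E (torsionLayer_anti E hkm hσ) _
      ((Submodule.mem_torsionBy_iff (R := ℤ) _ _).mp T.2))
  haveI : NeZero (p ^ k) := ⟨pow_ne_zero _ hp.ne_zero⟩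
  obtain ⟨i, -, rfl⟩ := hζ'.eq_pow_of_pow_eq_one hζ.pow_eq_one
  rw [smul_pow', hσ']

end Torsion

/-! ## §3 The Kummer frame on the torsion tower -/

namespace KummerFrame

variable {K : Type} [Field K] [NumberField K] (E : WeierstrassCurve K) [E.IsElliptic] (p : ℕ) [Fact p.Prime]
  (f : ℕ) (hf : 0 < f) (γ : E.tateModule p)

/-- ★ **The Kummer frame of `E/K` at `p` on the torsion tower** — levels `V s = Gal(K̄/K(E[p^s f]))` (for a CM curve and
`cond ∣ (f)`: `= Gal(K̄/K(p^s𝔣))`, (15.3.1)), the compatible primitive roots `primitiveRootUnit K p k`, and the torsion points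
`e k = γ mod p^k` of the given `γ ∈ T_pE`; (b1) holds because `E[p^k] ⊆ E[p^s f]` and `μ_{p^k} ⊆ K(E[p^s f])` for `k ≤ s`
(`smul_eq_of_isPrimitiveRoot_of_mem_torsionLayer`).  Every field is PROVED. [cite: Kato2004Asterisque, §15.5 (p.
253), (15.6.1) (p. 253), (15.12.1) (p. 263)] [cite: SilvermanAEC2009, Cor. III.8.1.1] -/
def ofTorsionTower : KummerFrame E p where
  V s := CM.torsionLayer E (p ^ s * f)
  isOpen_V s := WeierstrassCurve.isOpen_ker_galoisRepTorsion_holds E (n := ((p ^ s * f : ℕ) : ℤ))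
    (by exact_mod_cast mul_ne_zero (pow_ne_zero s (Fact.out : p.Prime).ne_zero) hf.ne')
  V_succ_le s := torsionLayer_anti E (mul_dvd_mul_right (pow_dvd_pow p (Nat.le_succ s)) f)
  ζ := primitiveRootUnit K p
  isPrimitiveRoot_ζ := isPrimitiveRoot_primitiveRootUnit K p
  ζ_succ_pow := primitiveRootUnit_succ_pow K p
  e k := tateModPkK E p k γ
  e_succ k := zsmul_coe_tateModPkK_succ E p k γ
  smul_ζ k s hks σ := Units.ext (by
    rw [Units.coe_smul]
    exact smul_eq_of_isPrimitiveRoot_of_mem_torsionLayer E p k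
      ((pow_dvd_pow p hks).trans (dvd_mul_right _ f)) σ.2
      (IsPrimitiveRoot.coe_units_iff.mpr (isPrimitiveRoot_primitiveRootUnit K p k)))
  smul_e k s hks σ := Subtype.ext (by
    rw [AddSubgroup.torsionBy.coe_smul]
    refine smul_eq_of_mem_torsionLayer E σ.2 _ ?_
    obtain ⟨c, hc⟩ : (p : ℤ) ^ k ∣ ((p ^ s * f : ℕ) : ℤ) := by
      exact_mod_cast (pow_dvd_pow p hks).trans (dvd_mul_right _ f)
    rw [hc, mul_comm, mul_zsmul, (Submodule.mem_torsionBy_iff (R := ℤ) _ _).mp (tateModPkK E p k γ).2, zsmul_zero])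

/-- The levels of the frame are the torsion kernels (`rfl`). [cite: Kato2004Asterisque, §15.3 (15.3.1) (p. 252)] -/
theorem ofTorsionTower_V (s : ℕ) : (ofTorsionTower E p f hf γ).V s = CM.torsionLayer E (p ^ s * f) := rfl

/-- The torsion points of the frame are `γ mod p^k` (`rfl`). [cite: Kato2004Asterisque, (15.12.1) (p. 263)] -/
theorem ofTorsionTower_e (k : ℕ) : (ofTorsionTower E p f hf γ).e k = tateModPkK E p k γ := rfl

/-- The roots of unity of the frame (`rfl`). [cite: Kato2004Asterisque, (15.6.1) (p. 253)] -/
theorem ofTorsionTower_ζ (k : ℕ) : (ofTorsionTower E p f hf γ).ζ k = primitiveRootUnit K p k := rfl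

/-- **`γ ≠ 0 ⟹ e k ≠ 0` for some `k`** (`T_pE ∋ γ = (γ mod p^k)_k`, `TateModule.ext`). [cite: Kato2004Asterisque,
(15.12.1) (p. 263)] -/
theorem exists_ofTorsionTower_e_ne_zero (hγ : γ ≠ 0) : ∃ k, (ofTorsionTower E p f hf γ).e k ≠ 0 := by
  by_contra h
  have h' : ∀ k, (ofTorsionTower E p f hf γ).e k = 0 := fun k ↦ not_not.mp (not_exists.mp h k)
  refine hγ (TateModule.ext fun k ↦ ?_)
  have := congrArg (fun x : geomTorsion E ((p : ℤ) ^ k) ↦ (x : geomPoints E)) (h' k)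
  simp only [ofTorsionTower_e, coe_tateModPkK_apply, ZeroMemClass.coe_zero] at this
  rw [this, map_zero]

/-- **`T_pE ≠ 0`**: a non-zero element of the Tate module exists (`rank_{ℤ_p} T_pE = 2`, Silverman III.7.1 (a), the tree's
`finrank_tateModule_eq_two_holds`). [cite: SilvermanAEC2009, Prop. III.7.1 (a)] -/
theorem exists_tateModule_ne_zero : ∃ γ : E.tateModule p, γ ≠ 0 := by
  haveI : Nontrivial (E.tateModule p) := Module.nontrivial_of_finrank_pos (R := ℤ_[p])
    (by rw [WeierstrassCurve.finrank_tateModule_eq_two_holds E p (by exact_mod_cast (Fact.out : p.Prime).ne_zero)]; omega)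
  exact exists_ne 0

include hf in
/-- ★ **The frame clause of `(F∃)_K`**: for every elliptic `E/K`, prime `p` and `f ≥ 1` there is a Kummer frame on the torsion
tower `V s = Gal(K̄/K(E[p^s f]))` with `e k ≠ 0` for some `k` — verbatim the first two conjuncts of the hypothesis `hF` of
`CM.prop159_ellipticUnits_expStar_values_of_kummerCup` (with `E := A.baseChange K`). [cite: Kato2004Asterisque, §15.5
(p. 253) and (15.12.1) (p. 263)] [cite: SilvermanAEC2009, Cor. III.8.1.1] -/
theorem exists_kummerFrame_torsionTower :
    ∃ F : KummerFrame E p, (∀ s : ℕ, F.V s = CM.torsionLayer E (p ^ s * f)) ∧ ∃ k : ℕ, F.e k ≠ 0 := by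
  obtain ⟨γ, hγ⟩ := exists_tateModule_ne_zero E p
  exact ⟨ofTorsionTower E p f hf γ, ofTorsionTower_V E p f hf γ, exists_ofTorsionTower_e_ne_zero E p f hf γ hγ⟩

end KummerFrame

end Literature.NumberTheory.EllipticCurves.Kato2004

end
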